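import Summits.BirchSwinnertonDyer.BirchSwinnertonDyer.Theorems.AlignedTransportAtTwoMainConjectureOfRankZeroBSDAtTwoHalfDescentLayerIndexGrowthFiniteTwistQuadratic
import Summits.BirchSwinnertonDyer.BirchSwinnertonDyer.Theorems.AlignedTransportAtTwoMainConjectureOfRankZeroBSDAtTwoFineRoadInfResSurj
import HarnessLib

/-!
# Route `AlignedTransportAtTwo`, crux C2 `MainConjectureOfRankZeroBSDAtTwo` (stmt-BirchSwinnertonDyer-22298):
# THE TWIST READING OF THE MINUS PART, IV — EXACT FORM: the minus part of `Sel_{2^∞}(E/K_{n+1})` IS the plus part of the twist, `Ψ(Sel⁺_{n+1}(E′)) = M_{n+1}(E)`;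
# on the seed cell the plus part is EXACTLY the relaxed Selmer group one layer down, `Sel⁺_{n+1}(E) = res(Sel♯_n(E))`, `Sel♯_n := res⁻¹(Sel_{p^∞}(E/K_{n+1})) ⊇ Sel_{p^∞}(E/K_n)`,
# `p·Sel♯_n ⊆ Sel_n`; hence `#M_{n+1}(E) = #Sel♯_n(E′)` — at the first layer `#ker(N_{K(√d)/K} | Sel_{2^∞}(E/K(√d))) = #{η ∈ H¹(K, E^{(d)}[2^∞]) : res η ∈ Sel_{2^∞}(E^{(d)}/K(√d))}`

HONEST FRAMING (cell `bsd-f1-sign2`, WIDTH-5 attached prover seat `bsd-line-att-p5` gen 58 on line `birth` of the lead `bsd-line-att-p2`;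
`--supports` stmt-BirchSwinnertonDyer-22298, closes nothing; BSD is NOT proved by any of this; the crux C2, its verdict «blocked-on
`Rank1Residual.GreenbergMuConjectureIrreducible`» and every registered stub (P / T / Kμ / LimDoor / MuIneqʳ / PFμ⁺) are untouched). THEOREMS ONLY — no `def`,
no instance, no named fact, no `sorry`. Sequel of `…GrowthFiniteTwist` (plus part), `…GrowthFiniteTwistMinus` (abstract twisting datum `Ψ`), `…GrowthFiniteTwistQuadratic`
(`W′ = W^{(d)}` at `K_1 = K(√d)`; `ℚ_1 = ℚ(√2)`), and of the tree's inflation–restriction between subgroups (`AlignedTransportAtTwoFineRoad.InfResSurj.exists_resOfLe_eq_of_forall_conjH1_eq`,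
att-p4 g3). Those files give SANDWICHES (`#Sel(W′/K_n) ∣ #M ∣ #Sel(W′/K_n)·#M[2]`); this file gives the EXACT object.

THE POINT. (§1, no hypothesis) `Ψ ∘ conj′_g = −conj_g ∘ Ψ` exchanges `±`-eigenspaces and `Ψ(Sel′_{n+1}) = Sel_{n+1}`, so **`Ψ(Sel′⁺_{n+1}) = M_{n+1}`** and **`Ψ(M′_{n+1}) = Sel⁺_{n+1}`**
(`map_twist_inf_ker_sub_eq_normKer`, `map_twist_normKer_eq_inf_ker_sub`): THE MINUS PART OF `E` IS THE PLUS PART OF THE TWIST (and `#Sel_{n+1}(E) = #Sel_{n+1}(E′)`, `#M(E) = #Sel⁺(E′)`,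
`#Sel⁺(E) = #M(E′)`). (§2, any `p`) With `E[p^∞]^{Gal(K̄/K_{n+1})} = 0` (⟸ `E(K)[p] = 0`, tree `fixedPoints_kerSubgroup_geomPrimaryTorsion_eq_bot`) inflation–restriction is EXACT:
a class of `H¹(K_{n+1}, E[p^∞])` fixed by `conj_{γ^{pⁿ}}` is fixed by all of `Gal(K̄/K_n)` (cosets `γ^{pⁿ i}`, `forall_conjH1_eq_of_conjH1_pow_eq`) hence a restriction
(`inf_ker_sub_eq_map_comap`): **`Sel⁺_{n+1} = res(Sel♯_n)`, `Sel♯_n := res⁻¹(Sel_{n+1})`**, the Selmer group over `K_n` with the local conditions RELAXED to those surviving in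
`K_{n+1}`; `Sel_n ≤ Sel♯_n`, `p·Sel♯_n ≤ Sel_n` (`cor ∘ res = p`, tree `coresLayer_resOfLe`), ★★ **`#Sel⁺_{n+1} = #Sel♯_n`**, `#Sel_n ∣ #Sel♯_n ∣ #Sel_n·#Sel♯_n[p]`.
(§3, `p = 2`) ★★★ **`#M_{n+1}(W) = #Sel♯_n(W′)`** when `W′[2^∞]^{Gal(K̄/K_{n+1})} = 0`: the signed object at finite level (gen 57) is EXACTLY the relaxed `2^∞`-Selmer group of the twist one
layer down; with gen 57's door: ★★★ **`0 < #Sel♯_n(W′)·#ker g_{n+1} < 2^{2ⁿ}` ⟹ `μ(X(W/K_∞)) = 0`** and on the seed cell **`2^{2ⁿμ} ∣ #Sel♯_n(W′)·#ker g_{n+1}`** — no `2`-torsion defect left.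
(§4) the quadratic twist at the first layer, any `K`, and `K = ℚ` cyclotomic (`ℚ_1 = ℚ(√2)`): ★★★ **`#ker(N_{K_1/K} | Sel_{2^∞}(W/K_1)) = #{η ∈ H¹(K, W^{(d)}[2^∞]) : res η ∈ Sel_{2^∞}(W^{(d)}/K_1)}`**,
**`2^{μ} ∣ #Sel♯_0(W^{(d)})·#ker g_1`**, and over `ℚ`: **`2^{μ₂(X(E/ℚ_∞))} ∣ #Sel♯_0(E^{(2)})·#ker g_1`** for every elliptic `E/ℚ` without a rational `2`-torsion abscissa.
What is NOT claimed: nothing numerical about any curve; no Selmer group computed; C2 untouched. Memo `Cruxes/MainConjectureOfRankZeroBSDAtTwo/TWIST-READING-att-p5-g58.md`.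

References: J.-P. Serre, *Galois Cohomology*, I.§2.6 (b) (inflation–restriction) [SerreGaloisCohomology1997]; J. Neukirch, A. Schmidt, K. Wingberg, I.§6 Prop. 1.6.7
[NeukirchSchmidtWingberg2008]; T. Dokchitser, V. Dokchitser, Ann. of Math. 172 (2010), Lemma 4.14 (proof) [DokchitserDokchitserAnnals2010]; T. Dokchitser (2013) §4
[Dokchitser2013ParityNotes]; R. Greenberg, LNM 1716 (1999), §1 p. 62, Conj. 1.11, §3 Lemmas 3.1–3.3, §4 p. 107, Lemma 4.3 [GreenbergLNM1716]; B. Mazur, K. Rubin, Invent. Math. 181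
(2010) §3 (twisted Selmer groups) [MazurRubin2010]; L. Washington, GTM 83 §13.1, §13.3 [Washington1997].
-/

set_option linter.dupNamespace false
set_option autoImplicit false

noncomputable section

open scoped Classical AddSubgroup Polynomial

universe u

namespace Summit.BirchSwinnertonDyer.BirchSwinnertonDyer.Theorems.AlignedTransportAtTwoHalfDescentLayerIndexGrowthFiniteTwistPlusMinus

open WeierstrassCurve Literature.NumberTheory.EllipticCurves Literature.NumberTheory.EllipticCurves.IwasawaDual
  Literature.NumberTheory.EllipticCurves.IwasawaAlgebra
  Literature.NumberTheory.EllipticCurves.Greenberg1999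
  Summit.BirchSwinnertonDyer.Rank1Residual.X1.MuLambda
  Summit.BirchSwinnertonDyer.Rank1Residual.Iwasawa
  Summit.BirchSwinnertonDyer.BirchSwinnertonDyer.Theorems
  Summit.BirchSwinnertonDyer.BirchSwinnertonDyer.Theorems.AlignedTransportAtTwoHalfDescentLayerIndexGrowthFinite
  Summit.BirchSwinnertonDyer.BirchSwinnertonDyer.Theorems.AlignedTransportAtTwoHalfDescentLayerIndexGrowthFiniteTwo
  Summit.BirchSwinnertonDyer.BirchSwinnertonDyer.Theorems.AlignedTransportAtTwoHalfDescentLayerIndexGrowthFiniteCell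
  Summit.BirchSwinnertonDyer.BirchSwinnertonDyer.Theorems.AlignedTransportAtTwoHalfDescentLayerIndexGrowthFiniteTwist
  Summit.BirchSwinnertonDyer.BirchSwinnertonDyer.Theorems.AlignedTransportAtTwoHalfDescentLayerIndexGrowthFiniteTwistMinus
  Summit.BirchSwinnertonDyer.BirchSwinnertonDyer.Theorems.AlignedTransportAtTwoHalfDescentLayerIndexGrowthFiniteTwistQuadratic

/-! ## §1 The minus part of `W` is the plus part of the twist (abstract twisting datum; no hypothesis) -/

section Exchange

variable {K : Type u} [Field K] [NumberField K] (W W' : WeierstrassCurve K) (κ : ZpExtension K 2) {γ : Field.absoluteGaloisGroup K} (n : ℕ)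
  (Ψ : W'.subgroupH1 2 (κ.layerSubgroup (n + 1)) ≃+ W.subgroupH1 2 (κ.layerSubgroup (n + 1)))

/-- ★★★ **`Ψ(Sel⁺_{n+1}(W′)) = M_{n+1}(W)`**: under a twisting datum (`Ψ(Sel′) = Sel`, `Ψ ∘ conj′_g = −conj_g ∘ Ψ`, `g = γ^{2ⁿ}`) the PLUS part `Sel_{2^∞}(W′/K_{n+1}) ∩ ker(conj′_g − 1)` of the
twist is carried EXACTLY onto the MINUS part `Sel_{2^∞}(W/K_{n+1}) ∩ ker(conj_g + 1)` (the kernel of the relative norm `N_{K_{n+1}/K_n}`). [cite: Dokchitser2013ParityNotes, §4]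
[cite: DokchitserDokchitserAnnals2010, Lemma 4.14 (proof)] [cite: GreenbergLNM1716, §4 p. 107] -/
theorem map_twist_inf_ker_sub_eq_normKer (hΨsel : ∀ x, x ∈ W'.selmerLayer κ (n + 1) ↔ Ψ x ∈ W.selmerLayer κ (n + 1))
    (hΨg : ∀ x, Ψ (W'.conjH1 2 (κ.layerSubgroup (n + 1)) (γ ^ 2 ^ n) x) = -(W.conjH1 2 (κ.layerSubgroup (n + 1)) (γ ^ 2 ^ n) (Ψ x))) :
    (W'.selmerLayer κ (n + 1) ⊓ (W'.conjH1 2 (κ.layerSubgroup (n + 1)) (γ ^ 2 ^ n) - AddMonoidHom.id (W'.subgroupH1 2 (κ.layerSubgroup (n + 1)))).ker).map (Ψ : W'.subgroupH1 2 (κ.layerSubgroup (n + 1)) →+ W.subgroupH1 2 (κ.layerSubgroup (n + 1))) =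
      W.selmerLayer κ (n + 1) ⊓ (W.conjH1 2 (κ.layerSubgroup (n + 1)) (γ ^ 2 ^ n) + AddMonoidHom.id (W.subgroupH1 2 (κ.layerSubgroup (n + 1)))).ker := by
  ext m
  constructor
  · rintro ⟨y, hy, rfl⟩
    obtain ⟨hyS, hyσ⟩ := AddSubgroup.mem_inf.mp hy
    rw [AddMonoidHom.mem_ker, AddMonoidHom.sub_apply, AddMonoidHom.id_apply, sub_eq_zero] at hyσ
    rw [AddMonoidHom.coe_coe]
    refine AddSubgroup.mem_inf.mpr ⟨(hΨsel y).mp hyS, ?_⟩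
    rw [AddMonoidHom.mem_ker, AddMonoidHom.add_apply, AddMonoidHom.id_apply]
    have h := hΨg y
    rw [hyσ] at h
    exact (add_comm _ _).trans (eq_neg_iff_add_eq_zero.mp h)
  · intro hm
    obtain ⟨hmS, -⟩ := AddSubgroup.mem_inf.mp hm
    have hσm := apply_eq_neg_of_mem_inf_ker _ _ hm
    refine ⟨Ψ.symm m, AddSubgroup.mem_inf.mpr ⟨(hΨsel _).mpr (by rw [AddEquiv.apply_symm_apply]; exact hmS), ?_⟩,
      by rw [AddMonoidHom.coe_coe, AddEquiv.apply_symm_apply]⟩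
    rw [AddMonoidHom.mem_ker, AddMonoidHom.sub_apply, AddMonoidHom.id_apply, sub_eq_zero]
    apply Ψ.injective
    rw [hΨg, AddEquiv.apply_symm_apply, hσm, neg_neg]

/-- ★★★ **`Ψ(M_{n+1}(W′)) = Sel⁺_{n+1}(W)`**: symmetrically, the minus part of the twist is carried onto the plus part of `W`. [cite: Dokchitser2013ParityNotes, §4]
[cite: DokchitserDokchitserAnnals2010, Lemma 4.14 (proof)] -/
theorem map_twist_normKer_eq_inf_ker_sub (hΨsel : ∀ x, x ∈ W'.selmerLayer κ (n + 1) ↔ Ψ x ∈ W.selmerLayer κ (n + 1))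
    (hΨg : ∀ x, Ψ (W'.conjH1 2 (κ.layerSubgroup (n + 1)) (γ ^ 2 ^ n) x) = -(W.conjH1 2 (κ.layerSubgroup (n + 1)) (γ ^ 2 ^ n) (Ψ x))) :
    (W'.selmerLayer κ (n + 1) ⊓ (W'.conjH1 2 (κ.layerSubgroup (n + 1)) (γ ^ 2 ^ n) + AddMonoidHom.id (W'.subgroupH1 2 (κ.layerSubgroup (n + 1)))).ker).map (Ψ : W'.subgroupH1 2 (κ.layerSubgroup (n + 1)) →+ W.subgroupH1 2 (κ.layerSubgroup (n + 1))) =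
      W.selmerLayer κ (n + 1) ⊓ (W.conjH1 2 (κ.layerSubgroup (n + 1)) (γ ^ 2 ^ n) - AddMonoidHom.id (W.subgroupH1 2 (κ.layerSubgroup (n + 1)))).ker := by
  ext m
  constructor
  · rintro ⟨y, hy, rfl⟩
    obtain ⟨hyS, -⟩ := AddSubgroup.mem_inf.mp hy
    have hσy := apply_eq_neg_of_mem_inf_ker _ _ hy
    rw [AddMonoidHom.coe_coe]
    refine AddSubgroup.mem_inf.mpr ⟨(hΨsel y).mp hyS, ?_⟩
    rw [AddMonoidHom.mem_ker, AddMonoidHom.sub_apply, AddMonoidHom.id_apply, sub_eq_zero]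
    have h := hΨg y
    rw [hσy, map_neg] at h
    exact neg_injective h.symm
  · intro hm
    obtain ⟨hmS, hmσ⟩ := AddSubgroup.mem_inf.mp hm
    rw [AddMonoidHom.mem_ker, AddMonoidHom.sub_apply, AddMonoidHom.id_apply, sub_eq_zero] at hmσ
    refine ⟨Ψ.symm m, AddSubgroup.mem_inf.mpr ⟨(hΨsel _).mpr (by rw [AddEquiv.apply_symm_apply]; exact hmS), ?_⟩,
      by rw [AddMonoidHom.coe_coe, AddEquiv.apply_symm_apply]⟩
    rw [AddMonoidHom.mem_ker, AddMonoidHom.add_apply, AddMonoidHom.id_apply]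
    apply Ψ.injective
    rw [map_add, map_zero, hΨg, AddEquiv.apply_symm_apply, hmσ, neg_add_cancel]

/-- `Ψ(Sel_{2^∞}(W′/K_{n+1})) = Sel_{2^∞}(W/K_{n+1})`. [cite: GreenbergLNM1716, §4 p. 107] -/
theorem map_twist_selmerLayer_eq (hΨsel : ∀ x, x ∈ W'.selmerLayer κ (n + 1) ↔ Ψ x ∈ W.selmerLayer κ (n + 1)) :
    (W'.selmerLayer κ (n + 1)).map (Ψ : W'.subgroupH1 2 (κ.layerSubgroup (n + 1)) →+ W.subgroupH1 2 (κ.layerSubgroup (n + 1))) = W.selmerLayer κ (n + 1) := by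
  ext m
  constructor
  · rintro ⟨y, hy, rfl⟩
    rw [AddMonoidHom.coe_coe]
    exact (hΨsel y).mp hy
  · intro hm
    exact ⟨Ψ.symm m, (hΨsel _).mpr (by rw [AddEquiv.apply_symm_apply]; exact hm), by rw [AddMonoidHom.coe_coe, AddEquiv.apply_symm_apply]⟩

/-- `#Sel_{2^∞}(W/K_{n+1}) = #Sel_{2^∞}(W′/K_{n+1})`. [cite: GreenbergLNM1716, §4 p. 107] -/
theorem natCard_selmerLayer_eq_natCard_twist (hΨsel : ∀ x, x ∈ W'.selmerLayer κ (n + 1) ↔ Ψ x ∈ W.selmerLayer κ (n + 1)) :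
    Nat.card (W.selmerLayer κ (n + 1)) = Nat.card (W'.selmerLayer κ (n + 1)) := by
  rw [← map_twist_selmerLayer_eq W W' κ n Ψ hΨsel]
  exact AddSubgroup.card_map_of_injective Ψ.injective

/-- ★★ **`#M_{n+1}(W) = #Sel⁺_{n+1}(W′)`**. [cite: DokchitserDokchitserAnnals2010, Lemma 4.14 (proof)] -/
theorem natCard_normKer_eq_natCard_twist_inf_ker_sub (hΨsel : ∀ x, x ∈ W'.selmerLayer κ (n + 1) ↔ Ψ x ∈ W.selmerLayer κ (n + 1))
    (hΨg : ∀ x, Ψ (W'.conjH1 2 (κ.layerSubgroup (n + 1)) (γ ^ 2 ^ n) x) = -(W.conjH1 2 (κ.layerSubgroup (n + 1)) (γ ^ 2 ^ n) (Ψ x))) :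
    Nat.card ↥(W.selmerLayer κ (n + 1) ⊓ (W.conjH1 2 (κ.layerSubgroup (n + 1)) (γ ^ 2 ^ n) + AddMonoidHom.id (W.subgroupH1 2 (κ.layerSubgroup (n + 1)))).ker) =
      Nat.card ↥(W'.selmerLayer κ (n + 1) ⊓ (W'.conjH1 2 (κ.layerSubgroup (n + 1)) (γ ^ 2 ^ n) - AddMonoidHom.id (W'.subgroupH1 2 (κ.layerSubgroup (n + 1)))).ker) := by
  rw [← map_twist_inf_ker_sub_eq_normKer W W' κ n Ψ hΨsel hΨg]
  exact AddSubgroup.card_map_of_injective Ψ.injective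

/-- ★★ **`#Sel⁺_{n+1}(W) = #M_{n+1}(W′)`**. [cite: DokchitserDokchitserAnnals2010, Lemma 4.14 (proof)] -/
theorem natCard_inf_ker_sub_eq_natCard_twist_normKer (hΨsel : ∀ x, x ∈ W'.selmerLayer κ (n + 1) ↔ Ψ x ∈ W.selmerLayer κ (n + 1))
    (hΨg : ∀ x, Ψ (W'.conjH1 2 (κ.layerSubgroup (n + 1)) (γ ^ 2 ^ n) x) = -(W.conjH1 2 (κ.layerSubgroup (n + 1)) (γ ^ 2 ^ n) (Ψ x))) :
    Nat.card ↥(W.selmerLayer κ (n + 1) ⊓ (W.conjH1 2 (κ.layerSubgroup (n + 1)) (γ ^ 2 ^ n) - AddMonoidHom.id (W.subgroupH1 2 (κ.layerSubgroup (n + 1)))).ker) =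
      Nat.card ↥(W'.selmerLayer κ (n + 1) ⊓ (W'.conjH1 2 (κ.layerSubgroup (n + 1)) (γ ^ 2 ^ n) + AddMonoidHom.id (W'.subgroupH1 2 (κ.layerSubgroup (n + 1)))).ker) := by
  rw [← map_twist_normKer_eq_inf_ker_sub W W' κ n Ψ hΨsel hΨg]
  exact AddSubgroup.card_map_of_injective Ψ.injective

end Exchange

/-! ## §2 Exact inflation–restriction on the seed cell: `Sel⁺_{n+1} = res(Sel♯_n)`, `Sel♯_n = res⁻¹(Sel_{n+1})` (any `p`) -/

section Plus

variable {K : Type u} [Field K] [NumberField K] (W : WeierstrassCurve K) {p : ℕ} [hp : Fact p.Prime] (κ : ZpExtension K p)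
  {γ : Field.absoluteGaloisGroup K}

omit [NumberField K] hp in
/-- The FixedPoints form of «no non-zero `H`-fixed point». [folklore] -/
theorem fixedPoints_eq_bot_of_forall (H : Subgroup (Field.absoluteGaloisGroup K))
    (h : ∀ m : W.geomPrimaryTorsion p, (∀ x ∈ H, x • m = m) → m = 0) : FixedPoints.addSubgroup H (W.geomPrimaryTorsion p) = ⊥ := by
  rw [eq_bot_iff]
  intro m hm
  rw [FixedPoints.mem_addSubgroup] at hm
  rw [AddSubgroup.mem_bot]
  exact h m fun x hx ↦ hm ⟨x, hx⟩

omit [NumberField K] hp in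
/-- The «∀» form of `M^H = 0`. [folklore] -/
theorem forall_eq_zero_of_fixedPoints_eq_bot (H : Subgroup (Field.absoluteGaloisGroup K)) (h : FixedPoints.addSubgroup H (W.geomPrimaryTorsion p) = ⊥) :
    ∀ m : W.geomPrimaryTorsion p, (∀ x ∈ H, x • m = m) → m = 0 := by
  intro m hm
  have hmem : m ∈ FixedPoints.addSubgroup H (W.geomPrimaryTorsion p) := by
    rw [FixedPoints.mem_addSubgroup]
    rintro ⟨x, hx⟩
    exact hm x hx
  rw [h] at hmem
  exact AddSubgroup.mem_bot.mp hmem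

/-- `E(K)[p] = 0 ⟹ E[p^∞]^{Gal(K̄/K_m)} = 0` for every layer (tree `fixedPoints_kerSubgroup_geomPrimaryTorsion_eq_bot`: `E(K_∞)[p^∞] = 0`, and `Gal(K̄/K_∞) ≤ Gal(K̄/K_m)`).
[cite: GreenbergLNM1716, §1 p. 62, §4 Lemma 4.3] -/
theorem fixedPoints_layerSubgroup_eq_bot [W.IsElliptic] (hK : ∀ P : W.toAffine.Point, p • P = 0 → P = 0) (m : ℕ) :
    FixedPoints.addSubgroup (κ.layerSubgroup m) (W.geomPrimaryTorsion p) = ⊥ := by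
  rw [eq_bot_iff]
  intro x hx
  rw [← W.fixedPoints_kerSubgroup_geomPrimaryTorsion_eq_bot κ hK]
  rw [FixedPoints.mem_addSubgroup] at hx ⊢
  rintro ⟨h, hh⟩
  exact hx ⟨h, κ.kerSubgroup_le_layerSubgroup m hh⟩

omit [NumberField K] in
/-- `Gal(K̄/K_{n+1})` is open in `Gal(K̄/K_n)` (subspace topology). [cite: Washington1997, §13.1] -/
theorem isOpen_layerSubgroup_subgroupOf (n : ℕ) :
    IsOpen (((κ.layerSubgroup (n + 1)).subgroupOf (κ.layerSubgroup n) : Subgroup (κ.layerSubgroup n)) : Set (κ.layerSubgroup n)) :=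
  (κ.isOpen_layerSubgroup (n + 1)).preimage continuous_subtype_val

omit [NumberField K] in
/-- **A class of `H¹(K_{n+1}, E[p^∞])` fixed by `conj_{γ^{pⁿ}}` is fixed by all of `Gal(K̄/K_n)`** (cosets of `Gal(K̄/K_{n+1})` represented by `γ^{pⁿ i}`, tree `bijective_layerCosetRep`;
inner classes act trivially). [cite: Washington1997, §13.1] [cite: SerreLocalFields1979, VII.§5 Prop. 3] -/
theorem forall_conjH1_eq_of_conjH1_pow_eq (hγ : κ.IsTopGenerator γ) (n : ℕ) {c : W.subgroupH1 p (κ.layerSubgroup (n + 1))} (hc : W.conjH1 p (κ.layerSubgroup (n + 1)) (γ ^ p ^ n) c = c) :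
    ∀ g ∈ κ.layerSubgroup n, W.conjH1 p (κ.layerSubgroup (n + 1)) g c = c := by
  intro g hg
  letI := κ.finite_layerQuotient_succ n
  letI : Fintype (κ.layerSubgroup n ⧸ (κ.layerSubgroup (n + 1)).subgroupOf (κ.layerSubgroup n)) := Fintype.ofFinite _
  obtain ⟨i, hi⟩ := (κ.bijective_layerCosetRep hγ n).2
    (((⟨g, hg⟩ : κ.layerSubgroup n) : κ.layerSubgroup n ⧸ (κ.layerSubgroup (n + 1)).subgroupOf (κ.layerSubgroup n)))
  have hi' : ((γ ^ p ^ n) ^ (i : ℕ))⁻¹ * g ∈ κ.layerSubgroup (n + 1) := by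
    have h := QuotientGroup.eq.mp hi
    rw [Subgroup.mem_subgroupOf, Subgroup.coe_mul, Subgroup.coe_inv] at h
    exact h
  have hg' : g = (γ ^ p ^ n) ^ (i : ℕ) * (((γ ^ p ^ n) ^ (i : ℕ))⁻¹ * g) := by rw [mul_inv_cancel_left]
  have hid : W.conjH1 p (κ.layerSubgroup (n + 1)) (((γ ^ p ^ n) ^ (i : ℕ))⁻¹ * g) = AddMonoidHom.id _ :=
    W.conjH1_of_mem_holds p (κ.layerSubgroup (n + 1)) hi'
  rw [hg', W.conjH1_mul_holds p (κ.layerSubgroup (n + 1)), AddMonoidHom.comp_apply, hid, AddMonoidHom.id_apply,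
    TowerCorank.conjH1_pow_apply W p]
  exact Function.iterate_fixed hc i

/-- ★★ **EXACT inflation–restriction at the layer: `Sel⁺_{n+1} = res(Sel♯_n)`, `Sel♯_n := res⁻¹(Sel_{p^∞}(E/K_{n+1}))`** when `E[p^∞]^{Gal(K̄/K_{n+1})} = 0`: every class of `Sel_{p^∞}(E/K_{n+1})`
fixed by `Gal(K_{n+1}/K_n)` IS a restriction from `K_n` (tree `InfResSurj.exists_resOfLe_eq_of_forall_conjH1_eq`), of a class satisfying the RELAXED local conditions.
[cite: SerreGaloisCohomology1997, I.§2.6 (b)] [cite: NeukirchSchmidtWingberg2008, I.§6 Prop. 1.6.7] [cite: GreenbergLNM1716, §3 Lemma 3.1] -/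
theorem inf_ker_sub_eq_map_comap (n : ℕ) (hfix : FixedPoints.addSubgroup (κ.layerSubgroup (n + 1)) (W.geomPrimaryTorsion p) = ⊥) (hγ : κ.IsTopGenerator γ) :
    W.selmerLayer κ (n + 1) ⊓ (W.conjH1 p (κ.layerSubgroup (n + 1)) (γ ^ p ^ n) - AddMonoidHom.id (W.subgroupH1 p (κ.layerSubgroup (n + 1)))).ker =
      ((W.selmerLayer κ (n + 1)).comap (W.resOfLe p (κ.layerSubgroup_antitone (Nat.le_succ n)))).map (W.resOfLe p (κ.layerSubgroup_antitone (Nat.le_succ n))) := by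
  ext c
  constructor
  · intro hc
    obtain ⟨hcS, hcσ⟩ := AddSubgroup.mem_inf.mp hc
    have hfix' : W.conjH1 p (κ.layerSubgroup (n + 1)) (γ ^ p ^ n) c = c := by
      rw [AddMonoidHom.mem_ker, AddMonoidHom.sub_apply, AddMonoidHom.id_apply, sub_eq_zero] at hcσ
      exact hcσ
    obtain ⟨c', hc'⟩ := AlignedTransportAtTwoFineRoad.InfResSurj.exists_resOfLe_eq_of_forall_conjH1_eq (M := W.geomPrimaryTorsion p)
      (κ.layerSubgroup_antitone (Nat.le_succ n)) hfix (isOpen_layerSubgroup_subgroupOf κ n) c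
      (forall_conjH1_eq_of_conjH1_pow_eq W κ hγ n hfix')
    refine ⟨c', ?_, hc'⟩
    have e : W.resOfLe p (κ.layerSubgroup_antitone (Nat.le_succ n)) c' = c := hc'
    show c' ∈ (W.selmerLayer κ (n + 1)).comap (W.resOfLe p (κ.layerSubgroup_antitone (Nat.le_succ n)))
    rw [AddSubgroup.mem_comap, e]
    exact hcS
  · rintro ⟨c', hc', rfl⟩
    refine AddSubgroup.mem_inf.mpr ⟨AddSubgroup.mem_comap.mp hc', ?_⟩
    rw [AddMonoidHom.mem_ker, AddMonoidHom.sub_apply, AddMonoidHom.id_apply, sub_eq_zero]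
    exact conjH1_resOfLe_layer_eq W κ (κ.pow_mem_layerSubgroup hγ n) c'

/-- ★★ **`#Sel⁺_{n+1} = #Sel♯_n`** when `E[p^∞]^{Gal(K̄/K_{n+1})} = 0` (then `res` is injective: tree `resOfLe_injective_of_forall_fixed_eq_zero`). [cite: SerreGaloisCohomology1997, I.§2.6 (b)]
[cite: GreenbergLNM1716, §3 Lemma 3.1] -/
theorem natCard_inf_ker_sub_eq_natCard_comap (n : ℕ) (hfix : FixedPoints.addSubgroup (κ.layerSubgroup (n + 1)) (W.geomPrimaryTorsion p) = ⊥) (hγ : κ.IsTopGenerator γ) :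
    Nat.card ↥(W.selmerLayer κ (n + 1) ⊓ (W.conjH1 p (κ.layerSubgroup (n + 1)) (γ ^ p ^ n) - AddMonoidHom.id (W.subgroupH1 p (κ.layerSubgroup (n + 1)))).ker) =
      Nat.card ↥((W.selmerLayer κ (n + 1)).comap (W.resOfLe p (κ.layerSubgroup_antitone (Nat.le_succ n)))) := by
  rw [inf_ker_sub_eq_map_comap W κ n hfix hγ]
  exact AddSubgroup.card_map_of_injective
    (resOfLe_injective_of_forall_fixed_eq_zero (M := W.geomPrimaryTorsion p) (κ.layerSubgroup_antitone (Nat.le_succ n))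
      (forall_eq_zero_of_fixedPoints_eq_bot W _ hfix))

/-- `Sel_{p^∞}(E/K_n) ≤ Sel♯_n` (restriction preserves the local conditions, tree `resOfLe_mem_selmerLayer`). [cite: GreenbergLNM1716, §1 Thm. 1.2] -/
theorem selmerLayer_le_comap (n : ℕ) : W.selmerLayer κ n ≤ (W.selmerLayer κ (n + 1)).comap (W.resOfLe p (κ.layerSubgroup_antitone (Nat.le_succ n))) :=
  fun _ hc ↦ AddSubgroup.mem_comap.mpr (W.resOfLe_mem_selmerLayer κ (Nat.le_succ n) hc)

/-- **`p · Sel♯_n ≤ Sel_{p^∞}(E/K_n)`**: `p·η = cor(res η)` and `cor(Sel_{n+1}) ⊆ Sel_n` (tree `coresLayer_resOfLe`, `coresLayer_mem_selmerLayer`). [cite: SerreGaloisCohomology1997, I.§2.4 Prop. 9]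
[cite: ClarkSharif2010, §3.6] -/
theorem nsmul_mem_selmerLayer_of_mem_comap (n : ℕ) {η : W.subgroupH1 p (κ.layerSubgroup n)}
    (hη : η ∈ (W.selmerLayer κ (n + 1)).comap (W.resOfLe p (κ.layerSubgroup_antitone (Nat.le_succ n)))) : p • η ∈ W.selmerLayer κ n := by
  rw [← W.coresLayer_resOfLe p κ n η]
  exact W.coresLayer_mem_selmerLayer p κ n (AddSubgroup.mem_comap.mp hη)

/-- ★ **`#Sel_n ∣ #Sel♯_n ∣ #Sel_n · #Sel♯_n[p]`** — the relaxed group exceeds the Selmer group by a `p`-torsion factor (the local conditions at the places where `K_{n+1}/K_n` changes them).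
No hypothesis. [cite: DokchitserDokchitserAnnals2010, Lemma 4.14 (proof)] [cite: GreenbergLNM1716, §3 Lemmas 3.2–3.3] -/
theorem natCard_selmerLayer_dvd_comap_and_dvd (n : ℕ) :
    Nat.card (W.selmerLayer κ n) ∣ Nat.card ↥((W.selmerLayer κ (n + 1)).comap (W.resOfLe p (κ.layerSubgroup_antitone (Nat.le_succ n)))) ∧
      Nat.card ↥((W.selmerLayer κ (n + 1)).comap (W.resOfLe p (κ.layerSubgroup_antitone (Nat.le_succ n)))) ∣
        Nat.card (W.selmerLayer κ n) *
          Nat.card ↥((W.selmerLayer κ (n + 1)).comap (W.resOfLe p (κ.layerSubgroup_antitone (Nat.le_succ n))) ⊓ AddSubgroup.torsionBy (W.subgroupH1 p (κ.layerSubgroup n)) p) :=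
  ⟨AddSubgroup.card_dvd_of_le (selmerLayer_le_comap W κ n),
    natCard_dvd_mul_natCard_inf_torsionBy _ _ p fun _ hm ↦ nsmul_mem_selmerLayer_of_mem_comap W κ n hm⟩

/-- ★★ Seed cell `E(K)[p] = 0`: **`#Sel⁺_{n+1} = #Sel♯_n`** and **`#Sel_n ∣ #Sel⁺_{n+1} ∣ #Sel_n · #Sel♯_n[p]`** at EVERY layer. [cite: GreenbergLNM1716, §3 Lemmas 3.1–3.3] -/
theorem natCard_inf_ker_sub_eq_natCard_comap_of_noTorsion [W.IsElliptic] (hK : ∀ P : W.toAffine.Point, p • P = 0 → P = 0) (hγ : κ.IsTopGenerator γ) (n : ℕ) :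
    Nat.card ↥(W.selmerLayer κ (n + 1) ⊓ (W.conjH1 p (κ.layerSubgroup (n + 1)) (γ ^ p ^ n) - AddMonoidHom.id (W.subgroupH1 p (κ.layerSubgroup (n + 1)))).ker) =
      Nat.card ↥((W.selmerLayer κ (n + 1)).comap (W.resOfLe p (κ.layerSubgroup_antitone (Nat.le_succ n)))) :=
  natCard_inf_ker_sub_eq_natCard_comap W κ n (fixedPoints_layerSubgroup_eq_bot W κ hK (n + 1)) hγ

end Plus

/-! ## §3 `p = 2`: the minus part is EXACTLY the relaxed Selmer group of the twist one layer down -/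

section Minus

variable {K : Type u} [Field K] [NumberField K] (W W' : WeierstrassCurve K) (κ : ZpExtension K 2) {γ : Field.absoluteGaloisGroup K} (n : ℕ)
  (Ψ : W'.subgroupH1 2 (κ.layerSubgroup (n + 1)) ≃+ W.subgroupH1 2 (κ.layerSubgroup (n + 1)))

/-- ★★★ **`#M_{n+1}(W) = #Sel♯_n(W′) = #{η ∈ H¹(K_n, W′[2^∞]) : res η ∈ Sel_{2^∞}(W′/K_{n+1})}`** when `W′[2^∞]^{Gal(K̄/K_{n+1})} = 0`: gen 57's signed object at finite level — the kernel of the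
relative norm `N_{K_{n+1}/K_n}` on `Sel_{2^∞}(W/K_{n+1})`, which carries the growth number of `X(W/K_∞)` — has EXACTLY the order of the relaxed `2^∞`-Selmer group of the twist over the
SMALLER field `K_n`. [cite: DokchitserDokchitserAnnals2010, Lemma 4.14 (proof)] [cite: Dokchitser2013ParityNotes, §4] [cite: SerreGaloisCohomology1997, I.§2.6 (b)] [cite: GreenbergLNM1716, §4 p. 107] -/
theorem natCard_normKer_eq_natCard_twist_comap (hγ : κ.IsTopGenerator γ) (hΨsel : ∀ x, x ∈ W'.selmerLayer κ (n + 1) ↔ Ψ x ∈ W.selmerLayer κ (n + 1))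
    (hΨg : ∀ x, Ψ (W'.conjH1 2 (κ.layerSubgroup (n + 1)) (γ ^ 2 ^ n) x) = -(W.conjH1 2 (κ.layerSubgroup (n + 1)) (γ ^ 2 ^ n) (Ψ x)))
    (hfix' : FixedPoints.addSubgroup (κ.layerSubgroup (n + 1)) (W'.geomPrimaryTorsion 2) = ⊥) :
    Nat.card ↥(W.selmerLayer κ (n + 1) ⊓ (W.conjH1 2 (κ.layerSubgroup (n + 1)) (γ ^ 2 ^ n) + AddMonoidHom.id (W.subgroupH1 2 (κ.layerSubgroup (n + 1)))).ker) =
      Nat.card ↥((W'.selmerLayer κ (n + 1)).comap (W'.resOfLe 2 (κ.layerSubgroup_antitone (Nat.le_succ n)))) := by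
  rw [natCard_normKer_eq_natCard_twist_inf_ker_sub W W' κ n Ψ hΨsel hΨg]
  exact natCard_inf_ker_sub_eq_natCard_comap W' κ n hfix' hγ

/-- ★★★ THE EXACT DOOR ON THE TWIST (any rank; `X` finitely generated torsion; `W′[2^∞]^{Gal(K̄/K_{n+1})} = 0`):
**`0 < #Sel♯_n(W′) · #ker g_{n+1} < 2^{2ⁿ}` at SOME layer ⟹ `μ(X(W/K_∞)) = 0`** — gen 57's norm-kernel door with `#M_{n+1} = #Sel♯_n(W′)`.
[cite: GreenbergLNM1716, Conj. 1.11, §3 Lemmas 3.1–3.3, §4 Lemma 4.3] [cite: Mazur1972, §6] [cite: Washington1997, §13.3 Thm. 13.13] -/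
theorem mu_eq_zero_of_natCard_twist_comap_mul_kerG_lt (hγ : κ.IsTopGenerator γ) (hΨsel : ∀ x, x ∈ W'.selmerLayer κ (n + 1) ↔ Ψ x ∈ W.selmerLayer κ (n + 1))
    (hΨg : ∀ x, Ψ (W'.conjH1 2 (κ.layerSubgroup (n + 1)) (γ ^ 2 ^ n) x) = -(W.conjH1 2 (κ.layerSubgroup (n + 1)) (γ ^ 2 ^ n) (Ψ x)))
    (hfix' : FixedPoints.addSubgroup (κ.layerSubgroup (n + 1)) (W'.geomPrimaryTorsion 2) = ⊥)
    (D : W.SelmerDualData κ γ) [Module.Finite (IwasawaAlgebra 2) D.X] (hD : D.IsTorsion)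
    (hpos : 0 < Nat.card ↥((W'.selmerLayer κ (n + 1)).comap (W'.resOfLe 2 (κ.layerSubgroup_antitone (Nat.le_succ n)))) * Nat.card (W.KerG κ (n + 1)))
    (hlt : Nat.card ↥((W'.selmerLayer κ (n + 1)).comap (W'.resOfLe 2 (κ.layerSubgroup_antitone (Nat.le_succ n)))) * Nat.card (W.KerG κ (n + 1)) < 2 ^ 2 ^ n) : D.mu = 0 := by
  rw [← natCard_normKer_eq_natCard_twist_comap W W' κ n Ψ hγ hΨsel hΨg hfix'] at hpos hlt
  exact mu_eq_zero_of_natCard_normKer_mul_kerG_lt W κ hγ D hD hpos hlt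

/-- ★★ Seed cell for BOTH curves (`W(K)[2] = 0`, `W′[2^∞]^{Gal(K̄/K_{n+1})} = 0`; `X` f.g. torsion): **`2^{2ⁿ·μ(X(W/K_∞))} ∣ #Sel♯_n(W′) · #ker g_{n+1}`** — no `2`-torsion defect left.
[cite: GreenbergLNM1716, Conj. 1.11, §3 Lemmas 3.1–3.3, §4 Lemma 4.3] [cite: Washington1997, §13.3 Thm. 13.13] -/
theorem pow_mu_dvd_natCard_twist_comap_mul_kerG [W.IsElliptic] (hK : ∀ P : W.toAffine.Point, 2 • P = 0 → P = 0) (hγ : κ.IsTopGenerator γ)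
    (hΨsel : ∀ x, x ∈ W'.selmerLayer κ (n + 1) ↔ Ψ x ∈ W.selmerLayer κ (n + 1))
    (hΨg : ∀ x, Ψ (W'.conjH1 2 (κ.layerSubgroup (n + 1)) (γ ^ 2 ^ n) x) = -(W.conjH1 2 (κ.layerSubgroup (n + 1)) (γ ^ 2 ^ n) (Ψ x)))
    (hfix' : FixedPoints.addSubgroup (κ.layerSubgroup (n + 1)) (W'.geomPrimaryTorsion 2) = ⊥)
    (D : W.SelmerDualData κ γ) [Module.Finite (IwasawaAlgebra 2) D.X] (hD : D.IsTorsion) :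
    2 ^ (2 ^ n * D.mu) ∣ Nat.card ↥((W'.selmerLayer κ (n + 1)).comap (W'.resOfLe 2 (κ.layerSubgroup_antitone (Nat.le_succ n)))) * Nat.card (W.KerG κ (n + 1)) := by
  rw [← natCard_normKer_eq_natCard_twist_comap W W' κ n Ψ hγ hΨsel hΨg hfix']
  have h := pow_dvd_natCard_map_selmerLayer_mul_kerG W κ hK hγ D hD n
  rw [show (2 : ℕ) - 1 = 1 from rfl, mul_one] at h
  exact h.trans (mul_dvd_mul_right (natCard_map_dvd_natCard_normKer W κ hγ n) _)

end Minus

/-! ## §4 The quadratic twist at the first layer (any `K`), and `K = ℚ` cyclotomic (`ℚ_1 = ℚ(√2)`) -/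

section Quadratic

variable {K : Type u} [Field K] [NumberField K] (W : WeierstrassCurve K) [W.IsElliptic] (κ : ZpExtension K 2) {γ : Field.absoluteGaloisGroup K}
  {d : K} {θ : AlgebraicClosure K}

/-- ★★★ **`#ker(N_{K_1/K} | Sel_{2^∞}(W/K_1)) = #{η ∈ H¹(K, W^{(d)}[2^∞]) : res η ∈ Sel_{2^∞}(W^{(d)}/K_1)}`** for EVERY number field `K`, `ℤ₂`-extension `κ` with topological generator `γ`, first
layer `K_1 = K(√d)`, and `W` with `W(K)[2] = 0`: the signed object at the first layer is EXACTLY the `K_1`-relaxed `2^∞`-Selmer group of the quadratic twist over the BASE.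
[cite: DokchitserDokchitserAnnals2010, Lemma 4.14 (proof)] [cite: Dokchitser2013ParityNotes, §4] [cite: GreenbergLNM1716, §4 p. 107] [cite: SilvermanAEC2009, X.2 Prop. 2.4] -/
theorem natCard_normKer_eq_natCard_quadraticTwist_comap (hK : ∀ P : W.toAffine.Point, 2 • P = 0 → P = 0) (hγ : κ.IsTopGenerator γ)
    (hd : d ≠ 0) (hθ : θ ^ 2 = algebraMap K (AlgebraicClosure K) d)
    (hθ1 : ∀ σ : Field.absoluteGaloisGroup K, σ ∈ κ.layerSubgroup 1 → σ • θ = θ) (hγθ : γ • θ = -θ) :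
    Nat.card ↥(W.selmerLayer κ 1 ⊓ (W.conjH1 2 (κ.layerSubgroup 1) γ + AddMonoidHom.id (W.subgroupH1 2 (κ.layerSubgroup 1))).ker) = Nat.card ↥(((W.quadraticTwist d).selmerLayer κ 1).comap ((W.quadraticTwist d).resOfLe 2 (κ.layerSubgroup_antitone (Nat.le_succ 0)))) := by
  obtain ⟨Ψ, hΨsel, hΨγ⟩ := AlignedTransportAtTwoHalfDescentLayerIndexGrowthFiniteTwistQuadratic.exists_twistDatum W κ hd hθ hθ1 hγθ
  have hΨg : ∀ x, Ψ ((W.quadraticTwist d).conjH1 2 (κ.layerSubgroup (0 + 1)) (γ ^ 2 ^ 0) x) =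
      -(W.conjH1 2 (κ.layerSubgroup (0 + 1)) (γ ^ 2 ^ 0) (Ψ x)) := by
    simpa only [pow_zero, pow_one] using hΨγ
  have hfix' : FixedPoints.addSubgroup (κ.layerSubgroup (0 + 1)) ((W.quadraticTwist d).geomPrimaryTorsion 2) = ⊥ :=
    fixedPoints_eq_bot_of_forall (W.quadraticTwist d) _ (AlignedTransportAtTwoHalfDescentLayerIndexGrowthFiniteTwistQuadratic.forall_fixed_quadraticTwist_eq_zero W κ hK hd hθ hθ1)
  have h := natCard_normKer_eq_natCard_twist_comap W (W.quadraticTwist d) κ 0 Ψ hγ hΨsel hΨg hfix'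
  simpa only [pow_zero, pow_one] using h

/-- ★★ **`2^{μ(X(W/K_∞))} ∣ #Sel♯_0(W^{(d)}) · #ker g_1`** (`W(K)[2] = 0`, `K_1 = K(√d)`, `X` f.g. torsion, any rank): `μ ≤ v₂ #{η ∈ H¹(K, W^{(d)}[2^∞]) : res η ∈ Sel(W^{(d)}/K_1)} + v₂ #ker g_1`.
[cite: GreenbergLNM1716, Conj. 1.11, §3 Lemmas 3.1–3.3, §4 Lemma 4.3] [cite: Washington1997, §13.3 Thm. 13.13] -/
theorem pow_mu_dvd_quadraticTwist_comap (hK : ∀ P : W.toAffine.Point, 2 • P = 0 → P = 0) (hγ : κ.IsTopGenerator γ)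
    (hd : d ≠ 0) (hθ : θ ^ 2 = algebraMap K (AlgebraicClosure K) d)
    (hθ1 : ∀ σ : Field.absoluteGaloisGroup K, σ ∈ κ.layerSubgroup 1 → σ • θ = θ) (hγθ : γ • θ = -θ)
    (D : W.SelmerDualData κ γ) [Module.Finite (IwasawaAlgebra 2) D.X] (hD : D.IsTorsion) :
    2 ^ D.mu ∣ Nat.card ↥(((W.quadraticTwist d).selmerLayer κ 1).comap ((W.quadraticTwist d).resOfLe 2 (κ.layerSubgroup_antitone (Nat.le_succ 0)))) * Nat.card (W.KerG κ 1) := by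
  obtain ⟨Ψ, hΨsel, hΨγ⟩ := AlignedTransportAtTwoHalfDescentLayerIndexGrowthFiniteTwistQuadratic.exists_twistDatum W κ hd hθ hθ1 hγθ
  have hΨg : ∀ x, Ψ ((W.quadraticTwist d).conjH1 2 (κ.layerSubgroup (0 + 1)) (γ ^ 2 ^ 0) x) =
      -(W.conjH1 2 (κ.layerSubgroup (0 + 1)) (γ ^ 2 ^ 0) (Ψ x)) := by
    simpa only [pow_zero, pow_one] using hΨγ
  have hfix' : FixedPoints.addSubgroup (κ.layerSubgroup (0 + 1)) ((W.quadraticTwist d).geomPrimaryTorsion 2) = ⊥ :=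
    fixedPoints_eq_bot_of_forall (W.quadraticTwist d) _ (AlignedTransportAtTwoHalfDescentLayerIndexGrowthFiniteTwistQuadratic.forall_fixed_quadraticTwist_eq_zero W κ hK hd hθ hθ1)
  have h := pow_mu_dvd_natCard_twist_comap_mul_kerG W (W.quadraticTwist d) κ 0 Ψ hK hγ hΨsel hΨg hfix' D hD
  simpa only [pow_zero, pow_one, one_mul] using h

end Quadratic

section Rat

variable (W : WeierstrassCurve ℚ) [W.IsElliptic] (κ : ZpExtension ℚ 2) {γ : Field.absoluteGaloisGroup ℚ}

/-- ★★★ `K = ℚ`, `κ` cyclotomic (`ℚ_1 = ℚ(√2)`), `E` elliptic without a rational `2`-torsion abscissa: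
**`#ker(N_{ℚ(√2)/ℚ} | Sel_{2^∞}(E/ℚ(√2))) = #{η ∈ H¹(ℚ, E^{(2)}[2^∞]) : res η ∈ Sel_{2^∞}(E^{(2)}/ℚ(√2))}`**. [cite: DokchitserDokchitserAnnals2010, Lemma 4.14 (proof)]
[cite: Washington1997, §13.1] [cite: GreenbergLNM1716, §4 p. 107] -/
theorem natCard_normKer_eq_natCard_quadraticTwist_two_comap (hκ : κ.IsCyclotomic) (hγ : κ.IsTopGenerator γ) (ht : ∀ x : ℚ, ¬ HasRationalTwoTorsionX W x) :
    Nat.card ↥(W.selmerLayer κ 1 ⊓ (W.conjH1 2 (κ.layerSubgroup 1) γ + AddMonoidHom.id (W.subgroupH1 2 (κ.layerSubgroup 1))).ker) = Nat.card ↥(((W.quadraticTwist 2).selmerLayer κ 1).comap ((W.quadraticTwist 2).resOfLe 2 (κ.layerSubgroup_antitone (Nat.le_succ 0)))) := by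
  obtain ⟨θ, hθ, hθ1, hγθ⟩ := AlignedTransportAtTwoHalfDescentLayerIndexGrowthFiniteTwistQuadratic.exists_sqrt_two_datum κ hκ hγ
  exact natCard_normKer_eq_natCard_quadraticTwist_comap W κ (forall_two_nsmul_eq_zero W ht) hγ two_ne_zero hθ hθ1 hγθ

/-- ★★ `K = ℚ`, `κ` cyclotomic, `E` elliptic without a rational `2`-torsion abscissa, ANY Pontryagin-dual datum with `X` f.g. torsion:
**`2^{μ₂(X(E/ℚ_∞))} ∣ #{η ∈ H¹(ℚ, E^{(2)}[2^∞]) : res η ∈ Sel_{2^∞}(E^{(2)}/ℚ(√2))} · #ker g_1`** — the seed's `μ₂` is bounded by the `ℚ(√2)`-relaxed `2^∞`-descent of `E^{(2)}` over `ℚ` and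
Greenberg's control kernel at `ℚ(√2)`. Nothing numerical is asserted. [cite: GreenbergLNM1716, Conj. 1.11, §3 Lemmas 3.1–3.3, §4 Lemma 4.3] [cite: Washington1997, §13.1, §13.3 Thm. 13.13] -/
theorem pow_mu_dvd_quadraticTwist_two_comap (hκ : κ.IsCyclotomic) (hγ : κ.IsTopGenerator γ) (ht : ∀ x : ℚ, ¬ HasRationalTwoTorsionX W x)
    (D : W.SelmerDualData κ γ) [Module.Finite (IwasawaAlgebra 2) D.X] (hD : D.IsTorsion) :
    2 ^ D.mu ∣ Nat.card ↥(((W.quadraticTwist 2).selmerLayer κ 1).comap ((W.quadraticTwist 2).resOfLe 2 (κ.layerSubgroup_antitone (Nat.le_succ 0)))) * Nat.card (W.KerG κ 1) := by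
  obtain ⟨θ, hθ, hθ1, hγθ⟩ := AlignedTransportAtTwoHalfDescentLayerIndexGrowthFiniteTwistQuadratic.exists_sqrt_two_datum κ hκ hγ
  exact pow_mu_dvd_quadraticTwist_comap W κ (forall_two_nsmul_eq_zero W ht) hγ two_ne_zero hθ hθ1 hγθ D hD

end Rat

end Summit.BirchSwinnertonDyer.BirchSwinnertonDyer.Theorems.AlignedTransportAtTwoHalfDescentLayerIndexGrowthFiniteTwistPlusMinus

end
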